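import Mathlib
import Summits.Ventures.PercRepro2.LocRows2
import Summits.Ventures.PercRepro2.LocSym

/-!
# The pairing form of (LOC-sym): a swap-symmetric involution of the source set
(blind cell PercRepro2, night-4; census 2026-08-23T22:10Z–22:40Z, own code)

For a fixed up-set `𝓤` the (LOC-sym) row asks for a bijection `ψ : M_𝓤 → P_𝓤` with
`diff(ζ, ψ ζ) ⊆ E(C_B(l)(ζ)) ∩ E(C_R(l)(ψ ζ))`. Composing with the colour swap, `τ := blue ∘ ψ` is a
permutation of `M_𝓤`, and the locality clause becomes a SYMMETRIC condition on the pair `(ζ, τ ζ)`: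
the two configurations AGREE exactly on `diff(ζ, ψ ζ)`, so

  every edge on which `ζ` and `τ ζ` agree touches `C_B(l)(ζ)` and touches `C_B(l)(τ ζ)`

(`PairRel`); equivalently `ζ` and `τ ζ` are complementary on every edge missing one of the two blue
clusters. **(PAIR-𝓤)** (`PairU`) asks for such a permutation that is an INVOLUTION — an unordered
pairing of `M_𝓤` (a configuration may be paired with itself exactly when every edge of the graph
touches its blue cluster, `pairRel_self_iff`). The pairing gives (LOC-sym) with `ψ = blue ∘ τ`
(`locSym_of_pairU`), hence (LOC-𝓤), 2′DOM2 and (BASE) on every fibre through the landed ladder.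

Census (night-4, exact, own enumerator `work/involU.py` + Edmonds blossom): a (PAIR-𝓤) involution
exists in EVERY `(l, h, 𝓤)` case with `M_𝓤 ≠ ∅` at `n = 4` (84 cases) and `n = 5` (2,768 cases, all
up-sets), and for the principal up-set `{S ∣ o ∈ S}` at `n = 6` (5,633 `(l, h, o)` cases, all 112
graphs) — a strictly stronger structural statement than the perfect-matching form (Tutte-type rather
than Hall-type). Greedy realisations fail: pairing every self-pairable configuration with itself
first leaves the rest unmatched in 110 / 460 (`n = 5`) and 1,515 / 5,633 (`n = 6`) cases. Statements
and the reduction only; no canonical pairing is known.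
-/

namespace Summit.Ventures.PercRepro2

namespace LocRows

open Hull

variable {V : Type*} {E : Type*} [Fintype E] [DecidableEq E]

open scoped Classical

variable (ends : E → Sym2 V)

/-- The pairing relation: every edge on which `ζ₁` and `ζ₂` agree touches the blue cluster of `l`
in `ζ₁` AND in `ζ₂` (so the two configurations are complementary off both blue clusters). -/
def PairRel (l : V) (ζ₁ ζ₂ : Config E) : Prop :=
  ∀ e, ζ₁ e = ζ₂ e →
    e ∈ touches ends (cluster ends (blue ζ₁) l) ∧ e ∈ touches ends (cluster ends (blue ζ₂) l)

omit [Fintype E] [DecidableEq E] in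
/-- The pairing relation is symmetric. -/
lemma PairRel.symm {l : V} {ζ₁ ζ₂ : Config E} (h : PairRel ends l ζ₁ ζ₂) : PairRel ends l ζ₂ ζ₁ :=
  fun e he => ⟨(h e he.symm).2, (h e he.symm).1⟩

omit [Fintype E] [DecidableEq E] in
/-- A configuration is paired with itself exactly when every edge touches its blue cluster. -/
lemma pairRel_self_iff {l : V} {ζ : Config E} :
    PairRel ends l ζ ζ ↔ ∀ e, e ∈ touches ends (cluster ends (blue ζ) l) :=
  ⟨fun h e => (h e rfl).1, fun h e _ => ⟨h e, h e⟩⟩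

/-- **(PAIR-𝓤)**: an involution of the source set `M_𝓤 = {h ∉ H_l, C_B(l) ∈ 𝓤, C_R(l) ∉ 𝓤}` whose
pairs satisfy `PairRel`. -/
def PairU (l h : V) (𝓤 : Set (Set V)) : Prop :=
  ∃ τ : {ζ // ζ ∈ srcU ends l h 𝓤} → {ζ // ζ ∈ srcU ends l h 𝓤},
    Function.Involutive τ ∧ ∀ x, PairRel ends l x.1 (τ x).1

omit [Fintype E] [DecidableEq E] in
/-- Two configurations differ on an edge iff the first agrees there with the colour swap of the
second. -/
lemma ne_blue_iff {ζ₁ ζ₂ : Config E} {e : E} : blue ζ₂ e ≠ ζ₁ e ↔ ζ₁ e = ζ₂ e := by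
  rw [blue_apply]
  cases ζ₁ e <;> cases ζ₂ e <;> simp

/-- The swap of a source configuration whose blue cluster is `𝓤`-good and red cluster is not lies
in the target set. -/
lemma blue_mem_tgtU {l h : V} {𝓤 : Set (Set V)} {ζ : Config E} (hζ : ζ ∈ srcU ends l h 𝓤) :
    blue ζ ∈ tgtU ends l h 𝓤 := by
  simp only [srcU, Finset.mem_filter, Finset.mem_univ, true_and] at hζ
  simp only [tgtU, Finset.mem_filter, Finset.mem_univ, true_and, hull_blue, blue_blue]
  exact ⟨hζ.1, hζ.2.1, hζ.2.2⟩

/-- **The pairing gives (LOC-sym)**: `ψ := blue ∘ τ` is a bijection `M_𝓤 → P_𝓤` that is `C_B(l)`-local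
at the source and `C_R(l)`-local at the image. -/
theorem locSym_of_pairU (l h : V) (𝓤 : Set (Set V)) (hp : PairU ends l h 𝓤) :
    LocSym ends l h 𝓤 := by
  obtain ⟨τ, hτ, hrel⟩ := hp
  refine ⟨fun x => blue (τ x).1, ?_, ?_⟩
  · intro x y hxy
    have h1 : (τ x).1 = (τ y).1 := by
      have := congrArg blue hxy
      simpa [blue_blue] using this
    exact hτ.injective (Subtype.ext h1)
  · intro x
    refine ⟨blue_mem_tgtU ends (τ x).2, ?_, ?_⟩
    · intro e he
      exact (hrel x e (ne_blue_iff.1 he)).1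
    · intro e he
      have he' : blue (τ x).1 e ≠ x.1 e := fun h => he h.symm
      have h1 := (hrel x e (ne_blue_iff.1 he')).2
      simpa [blue_blue] using h1

/-- (PAIR-𝓤) ⟹ (LOC-𝓤). -/
theorem locU_of_pairU (l h : V) (𝓤 : Set (Set V)) (hp : PairU ends l h 𝓤) : LocU ends l h 𝓤 :=
  locU_of_locSym ends l h 𝓤 (locSym_of_pairU ends l h 𝓤 hp)

/-- (PAIR-𝓤) over all finite graphs, markings `l ≠ h` and up-sets `𝓤`. -/
def PairU_all : Prop :=
  ∀ (V E : Type) [Fintype V] [DecidableEq V] [Fintype E] [DecidableEq E] (ends : E → Sym2 V)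
    (l h : V), l ≠ h → ∀ 𝓤 : Set (Set V), IsUpperSet 𝓤 → PairU ends l h 𝓤

/-- (PAIR-𝓤) for all instances gives (LOC-sym) for all instances. -/
theorem locSym_all_of_pairU_all (hp : PairU_all) : LocSym_all := by
  intro V E _ _ _ _ ends l h hlh 𝓤 h𝓤
  exact locSym_of_pairU ends l h 𝓤 (hp V E ends l h hlh 𝓤 h𝓤)

end LocRows

end Summit.Ventures.PercRepro2
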